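import Summits.Langlands.Langlands.Theses.ParityBlindBianchi
import Literature.NumberTheory.Automorphic.BaseChangeCyclicCuspidal
import Literature.NumberTheory.Automorphic.BaseChangeStrongUnramified
import Literature.NumberTheory.Automorphic.BaseChangeStrongAllFinite
import Literature.NumberTheory.Automorphic.BaseChangeArchimedean

/-!
# `QuadraticBaseChangeGL2` (stmt-Langlands-16812): what a refutation would have to contain

Negative-side lemmas (crux disprover `cdisprove-stmt-Langlands-16812`, 2026-08-17; supports
stmt-Langlands-16812; the crux work file is `Cruxes/QuadraticBaseChangeGL2/Disproof.lean`).

The crux is the conjunction of four clauses, each a `∀` over cuspidal automorphic representation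
data `CuspidalAutomorphicRepData 2 _ _` of `GL₂` (Borel–Jacquet datum model of the tree), and each
the verbatim `n = 2`, `[E:F] = 2` specialisation of a vendored Literature fact:
(a) `baseChange_cyclic_cuspidal` (Arthur–Clozel 1989, Ch. 3 Thm 4.2 (a)),
(b) `ArthurClozel1989_strongLifting_unramified`, (c) `…_allFinite`, (d) `…_archimedean`
(Ch. 3 Thm 5.1 with Ch. 1 §6–7).  Two consequences for any would-be refutation `¬ crux`:

* `not_baseChangeFacts_of_not_quadraticBaseChangeGL2` — it refutes the conjunction of those four
  printed theorems at `n = 2` (so it can only be vocabulary drift of the shared datum model);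
* `exists_cuspidal_of_not_quadraticBaseChangeGL2` — it INHABITS `CuspidalAutomorphicRepData 2 F hF`
  for some number field `F`, i.e. proves an instance of the undischarged inhabitation fact
  `nonempty_cuspidalAutomorphicRepData_two` (Gelbart 1975, Thm 7.11).  The tree constructs no cusp
  form on `GL₂` (its only explicit automorphic forms factor through `det`), so no junk-model,
  small-model or degenerate-parameter refutation exists: the disprover's "resists" is forced.

Both are proved by exhibiting the crux under the respective (vacuous / conditional) hypothesis
INSIDE the proof; no declaration of this file concludes a Theses statement.
-/

noncomputable section

set_option linter.dupNamespace false -- `Summit.Langlands.Langlands` is the mandated namespace (D-0017)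

open scoped NumberField
open NumberField IsDedekindDomain
open Literature.NumberTheory.Automorphic
open Summit.Langlands.Langlands.Theses.ParityBlindBianchi

namespace Summit.Langlands.Langlands.Theorems.QuadraticBaseChangeGL2.Negative

/-- `[E : F] = 2` is a prime degree. [folklore] -/
theorem prime_finrank_of_finrank_eq_two {F E : Type*} [Field F] [Field E] [Algebra F E]
    (h2 : Module.finrank F E = 2) : (Module.finrank F E).Prime := by
  rw [h2]; exact Nat.prime_two

/-- A Galois extension of degree `2` has cyclic Galois group (order `2`). [folklore] -/
theorem isCyclic_aut_of_finrank_eq_two {F E : Type*} [Field F] [Field E] [Algebra F E]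
    [IsGalois F E] (h2 : Module.finrank F E = 2) : IsCyclic (E ≃ₐ[F] E) :=
  haveI : FiniteDimensional F E := Module.finite_of_finrank_eq_succ h2
  isCyclic_of_prime_card (p := Module.finrank F E) (hp := ⟨prime_finrank_of_finrank_eq_two h2⟩)
    (IsGalois.card_aut_eq_finrank F E)

/-- **A refutation of the crux refutes printed theorems.**  `¬ QuadraticBaseChangeGL2` negates the
conjunction of the four vendored base-change facts (Arthur–Clozel 1989, Ch. 3 Thm 4.2 (a), Thm 5.1
with Ch. 1 §6–7; Langlands 1980 for `GL(2)`), because the crux is their verbatim specialisation at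
`n = 2`, `[E:F] = 2` (prime degree; cyclic Galois group for the archimedean clause).
[cite: ArthurClozelAMS120, Ch. 3 Thm 4.2 (a), Thm 5.1] -/
theorem not_baseChangeFacts_of_not_quadraticBaseChangeGL2 (hn : ¬ QuadraticBaseChangeGL2) :
    ¬ (baseChange_cyclic_cuspidal ∧ ArthurClozel1989_strongLifting_unramified ∧
        ArthurClozel1989_strongLifting_allFinite ∧ ArthurClozel1989_strongLifting_archimedean) := by
  rintro ⟨ha, hb, hc, hd⟩
  refine hn ⟨?_, ?_, ?_, ?_⟩
  · intro F E _ _ _ _ _ _ h2 hF π hw hE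
    exact ha 2 F E (prime_finrank_of_finrank_eq_two h2) hF π hw hE
  · intro F E _ _ _ _ _ _ h2 hF hE π P hlift
    exact hb 2 F E (prime_finrank_of_finrank_eq_two h2) hF hE π P hlift
  · intro F E _ _ _ _ _ _ h2 hF hE π P hlift
    exact hc 2 F E (prime_finrank_of_finrank_eq_two h2) hF hE π P hlift
  · intro F E _ _ _ _ _ _ h2 hF hE π P hlift
    exact hd 2 F E hF hE (isCyclic_aut_of_finrank_eq_two h2) (prime_finrank_of_finrank_eq_two h2)
      π P hlift

/-- **Refutation barrier.**  Any proof of `¬ QuadraticBaseChangeGL2` yields a number field `F` and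
an inhabitant of `CuspidalAutomorphicRepData 2 F hF`: if every such type were empty, all four
clauses (each a `∀ π : CuspidalAutomorphicRepData 2 F hF, …`) would hold vacuously.  Hence a
refutation proves an instance of the undischarged inhabitation fact
`nonempty_cuspidalAutomorphicRepData_two` (Gelbart 1975, Thm 7.11: `π(λ)` is cuspidal for a
non-Galois-invariant Grössencharakter `λ` of a quadratic `L/F`); no cusp form on `GL₂` being
constructible in the tree, no unconditional refutation is available.
[cite: Gelbart1975, Thm. 7.11] -/
theorem exists_cuspidal_of_not_quadraticBaseChangeGL2 (hn : ¬ QuadraticBaseChangeGL2) :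
    ∃ (F : Type) (_ : Field F) (_ : NumberField F) (hF : isCompact_glFiniteIntegralLevel 2 F),
      Nonempty (CuspidalAutomorphicRepData 2 F hF) := by
  by_contra hne
  push Not at hne
  refine hn ⟨?_, ?_, ?_, ?_⟩
  · intro F E _ _ _ _ _ _ _ hF π
    exact (hne F _ _ hF).elim π
  · intro F E _ _ _ _ _ _ _ hF hE π
    exact (hne F _ _ hF).elim π
  · intro F E _ _ _ _ _ _ _ hF hE π
    exact (hne F _ _ hF).elim π
  · intro F E _ _ _ _ _ _ _ hF hE π
    exact (hne F _ _ hF).elim π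

/-- Equivalent reading of the barrier against the inhabitation fact: if the crux fails then
`nonempty_cuspidalAutomorphicRepData_two` holds AT SOME FIELD — the refuter, not the prover, would be
the first to exhibit a cusp form on `GL₂` in the tree. [cite: Gelbart1975, Thm. 7.11] -/
theorem not_forall_isEmpty_cuspidal_of_not_quadraticBaseChangeGL2 (hn : ¬ QuadraticBaseChangeGL2) :
    ¬ ∀ (F : Type) [Field F] [NumberField F] (hF : isCompact_glFiniteIntegralLevel 2 F),
        IsEmpty (CuspidalAutomorphicRepData 2 F hF) := by
  intro h
  obtain ⟨F, _, _, hF, ⟨π⟩⟩ := exists_cuspidal_of_not_quadraticBaseChangeGL2 hn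
  exact (h F hF).elim π

end Summit.Langlands.Langlands.Theorems.QuadraticBaseChangeGL2.Negative

end
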